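import Mathlib.Probability.Distributions.Gaussian.Real
import Mathlib.Analysis.SpecialFunctions.Trigonometric.Bounds
import Mathlib.Algebra.Field.GeomSum
import HarnessLib

/-!
# Ajanki–Huveneers 2011, towards the lower bound (5.2) of Prop. 5.1: Fejér smoothing on the circle

Pure harmonic analysis, no chain. For a real random variable `Y` on a probability space we turn

* a translation bound `|𝔼φ(Y) - 𝔼φ(Y - s)| ≤ C₁|s| + ε₀` (continuous `1`-periodic `|φ| ≤ 1`,
  `|s| ≤ 1/2`) and
* closeness of the low Fourier coefficients of the law of `Y mod 1` to Gaussian ones,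
  `|𝔼cos 2πd Y - e^{-2π²d²V} cos 2πd a| ≤ δ`, `|𝔼sin 2πd Y - e^{-2π²d²V} sin 2πd a| ≤ δ`
  (`d = k - k'`, `k, k' < m`),

into the MINORISATION `𝔼F(Y) ≥ (g(V) - 2mδ) ∫_𝕋 F - A (2C₁/√m + ε₀)` for continuous `1`-periodic
`0 ≤ F ≤ A`, with `g(V) = e^{-2/V}/√(2πV)` (`smoothing_lower_bound`). The device is the Fejér kernel
`F_m = (1/m)|∑_{k<m} e^{2πiks}|² ≥ 0`: `𝔼(F ∗ F_m)(Y)` is a finite combination of the low Fourier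
coefficients, hence close to `∫ F(t) G(a - t) dt` with `G = F_m ∗ 𝒩(0,V) ≥ g(V)` (a Gaussian
average of a non-negative kernel of unit mass on every period), while
`|𝔼F(Y) - 𝔼(F ∗ F_m)(Y)| ≤ A ∫ F_m(s)(C₁|s| + ε₀) ds ≤ A(2C₁/√m + ε₀)` by `F_m(s) ≤ 1/(4ms²)`.

[cite: AjankiHuveneers2011, Prop. 5.1 eq. (5.2) (the statement served); folklore (Fejér kernel,
Gaussian characteristic function)]
-/

noncomputable section

open Real MeasureTheory Set Finset ProbabilityTheory
open scoped NNReal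

namespace Literature.Barriers.AtomisticToContinuum.HeatConduction

/-! ### The Fejér kernel -/

/-- The Fejér kernel of order `m` on the circle `ℝ/ℤ`:
`F_m(s) = (1/m) ((∑_{k<m} cos 2πks)² + (∑_{k<m} sin 2πks)²) = (1/m)|∑_{k<m} e^{2πiks}|²`. [folklore] -/
def fejer (m : ℕ) (s : ℝ) : ℝ :=
  (1 / m) * ((∑ k ∈ range m, Real.cos (2 * π * k * s)) ^ 2 + (∑ k ∈ range m, Real.sin (2 * π * k * s)) ^ 2)

/-- `F_m ≥ 0`. [folklore] -/
theorem fejer_nonneg (m : ℕ) (s : ℝ) : 0 ≤ fejer m s := by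
  unfold fejer; positivity

/-- The double-sum form `F_m(s) = (1/m) ∑_{k,k'<m} cos 2π(k-k')s`. [folklore] -/
theorem fejer_eq_sum_sum (m : ℕ) (s : ℝ) :
    fejer m s = (1 / m) * ∑ k ∈ range m, ∑ k' ∈ range m, Real.cos (2 * π * ((k : ℝ) - k') * s) := by
  unfold fejer
  congr 1
  rw [sq, sq, Finset.sum_mul_sum, Finset.sum_mul_sum, ← Finset.sum_add_distrib]
  refine Finset.sum_congr rfl fun k _ => ?_
  rw [← Finset.sum_add_distrib]
  refine Finset.sum_congr rfl fun k' _ => ?_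
  rw [show 2 * π * ((k : ℝ) - k') * s = 2 * π * k * s - 2 * π * k' * s by ring, Real.cos_sub]

/-- `F_m` is `1`-periodic. [folklore] -/
theorem fejer_periodic (m : ℕ) : Function.Periodic (fejer m) 1 := by
  intro s
  unfold fejer
  have hc : ∀ k : ℕ, Real.cos (2 * π * k * (s + 1)) = Real.cos (2 * π * k * s) := fun k => by
    rw [show 2 * π * k * (s + 1) = 2 * π * k * s + k * (2 * π) by ring, Real.cos_add_nat_mul_two_pi]
  have hs : ∀ k : ℕ, Real.sin (2 * π * k * (s + 1)) = Real.sin (2 * π * k * s) := fun k => by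
    rw [show 2 * π * k * (s + 1) = 2 * π * k * s + k * (2 * π) by ring, Real.sin_add_nat_mul_two_pi]
  simp only [hc, hs]

/-- `F_m` is continuous. [folklore] -/
theorem continuous_fejer (m : ℕ) : Continuous (fejer m) := by
  unfold fejer; fun_prop

/-- `F_m ≤ 2m`. [folklore] -/
theorem fejer_le (m : ℕ) (s : ℝ) : fejer m s ≤ 2 * m := by
  rcases Nat.eq_zero_or_pos m with rfl | hm
  · simp [fejer]
  have hmr : (0 : ℝ) < m := by exact_mod_cast hm
  have h1 : |∑ k ∈ range m, Real.cos (2 * π * k * s)| ≤ m := by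
    calc |∑ k ∈ range m, Real.cos (2 * π * k * s)| ≤ ∑ k ∈ range m, |Real.cos (2 * π * k * s)| :=
          Finset.abs_sum_le_sum_abs _ _
      _ ≤ ∑ _k ∈ range m, (1 : ℝ) := Finset.sum_le_sum fun k _ => Real.abs_cos_le_one _
      _ = m := by simp
  have h2 : |∑ k ∈ range m, Real.sin (2 * π * k * s)| ≤ m := by
    calc |∑ k ∈ range m, Real.sin (2 * π * k * s)| ≤ ∑ k ∈ range m, |Real.sin (2 * π * k * s)| :=
          Finset.abs_sum_le_sum_abs _ _
      _ ≤ ∑ _k ∈ range m, (1 : ℝ) := Finset.sum_le_sum fun k _ => Real.abs_sin_le_one _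
      _ = m := by simp
  have h1' : (∑ k ∈ range m, Real.cos (2 * π * k * s)) ^ 2 ≤ (m : ℝ) ^ 2 := by
    rw [← sq_abs]; exact pow_le_pow_left₀ (abs_nonneg _) h1 2
  have h2' : (∑ k ∈ range m, Real.sin (2 * π * k * s)) ^ 2 ≤ (m : ℝ) ^ 2 := by
    rw [← sq_abs]; exact pow_le_pow_left₀ (abs_nonneg _) h2 2
  unfold fejer
  calc 1 / (m : ℝ) * ((∑ k ∈ range m, Real.cos (2 * π * k * s)) ^ 2 +
        (∑ k ∈ range m, Real.sin (2 * π * k * s)) ^ 2) ≤ 1 / (m : ℝ) * ((m : ℝ) ^ 2 + (m : ℝ) ^ 2) :=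
        mul_le_mul_of_nonneg_left (add_le_add h1' h2') (by positivity)
    _ = 2 * (m : ℝ) := by field_simp; ring

/-- The square form is the squared norm of the complex geometric sum. [folklore] -/
theorem fejer_eq_norm_sq (m : ℕ) (s : ℝ) :
    fejer m s = (1 / m) * ‖∑ k ∈ range m, Complex.exp (2 * π * k * s * Complex.I)‖ ^ 2 := by
  unfold fejer
  congr 1
  have hre : (∑ k ∈ range m, Complex.exp (2 * π * k * s * Complex.I)).re =
      ∑ k ∈ range m, Real.cos (2 * π * k * s) := by
    rw [Complex.re_sum]
    refine Finset.sum_congr rfl fun k _ => ?_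
    rw [show (2 * π * k * s * Complex.I : ℂ) = ((2 * π * k * s : ℝ) : ℂ) * Complex.I by push_cast; ring,
      Complex.exp_ofReal_mul_I_re]
  have him : (∑ k ∈ range m, Complex.exp (2 * π * k * s * Complex.I)).im =
      ∑ k ∈ range m, Real.sin (2 * π * k * s) := by
    rw [Complex.im_sum]
    refine Finset.sum_congr rfl fun k _ => ?_
    rw [show (2 * π * k * s * Complex.I : ℂ) = ((2 * π * k * s : ℝ) : ℂ) * Complex.I by push_cast; ring,
      Complex.exp_ofReal_mul_I_im]
  rw [Complex.sq_norm, Complex.normSq_apply, hre, him]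
  ring

/-- **Decay of the Fejér kernel**: `F_m(s) ≤ 1/(4 m s²)` for `0 < |s| ≤ 1/2`. [folklore] -/
theorem fejer_le_inv_sq {m : ℕ} (hm : 0 < m) {s : ℝ} (hs0 : s ≠ 0) (hs : |s| ≤ 1 / 2) :
    fejer m s ≤ 1 / (4 * m * s ^ 2) := by
  have hmr : (0 : ℝ) < m := by exact_mod_cast hm
  -- `|sin π s| ≥ 2|s|`
  have hsin : 2 * |s| ≤ |Real.sin (π * s)| := by
    have h1 : 2 / π * (π * |s|) ≤ Real.sin (π * |s|) :=
      Real.mul_le_sin (by positivity) (by nlinarith [Real.pi_pos])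
    rw [show 2 / π * (π * |s|) = 2 * |s| by field_simp] at h1
    calc 2 * |s| ≤ Real.sin (π * |s|) := h1
      _ ≤ |Real.sin (π * |s|)| := le_abs_self _
      _ = |Real.sin (π * s)| := by
          rcases abs_choice s with h | h
          · rw [h]
          · rw [h, mul_neg, Real.sin_neg, abs_neg]
  have hsin0 : Real.sin (π * s) ≠ 0 := by
    intro h0
    rw [h0, abs_zero] at hsin
    have : 0 < |s| := abs_pos.mpr hs0
    linarith
  -- the geometric sum
  set z : ℂ := Complex.exp (2 * π * s * Complex.I) with hz
  have hz1 : z ≠ 1 := by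
    intro h1
    have hn : ‖z - 1‖ = 0 := by rw [h1, sub_self, norm_zero]
    rw [hz, show (2 * π * s * Complex.I : ℂ) = Complex.I * ((2 * π * s : ℝ) : ℂ) by push_cast; ring,
      Complex.norm_exp_I_mul_ofReal_sub_one, show (2 * π * s) / 2 = π * s by ring] at hn
    simp only [Real.norm_eq_abs, abs_mul, abs_two, mul_eq_zero, OfNat.ofNat_ne_zero, false_or,
      abs_eq_zero] at hn
    exact hsin0 hn
  have hgeom : ∑ k ∈ range m, Complex.exp (2 * π * k * s * Complex.I) = (z ^ m - 1) / (z - 1) := by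
    rw [← geom_sum_eq hz1 m]
    refine Finset.sum_congr rfl fun k _ => ?_
    rw [hz, ← Complex.exp_nat_mul]
    congr 1; ring
  have hnum : ‖z ^ m - 1‖ ≤ 2 := by
    calc ‖z ^ m - 1‖ ≤ ‖z ^ m‖ + ‖(1 : ℂ)‖ := norm_sub_le _ _
      _ = 2 := by
          rw [norm_pow, hz, show (2 * π * s * Complex.I : ℂ) = ((2 * π * s : ℝ) : ℂ) * Complex.I by
            push_cast; ring, Complex.norm_exp_ofReal_mul_I, one_pow, norm_one]; norm_num
  have hden : ‖z - 1‖ = 2 * |Real.sin (π * s)| := by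
    rw [hz, show (2 * π * s * Complex.I : ℂ) = Complex.I * ((2 * π * s : ℝ) : ℂ) by push_cast; ring,
      Complex.norm_exp_I_mul_ofReal_sub_one, show (2 * π * s) / 2 = π * s by ring, Real.norm_eq_abs,
      abs_mul, abs_two]
  have hden0 : 0 < ‖z - 1‖ := by rw [hden]; positivity
  have hsum : ‖∑ k ∈ range m, Complex.exp (2 * π * k * s * Complex.I)‖ ≤ 1 / (2 * |s|) := by
    rw [hgeom, norm_div, div_le_div_iff₀ hden0 (by positivity), hden]
    calc ‖z ^ m - 1‖ * (2 * |s|) ≤ 2 * (2 * |s|) := mul_le_mul_of_nonneg_right hnum (by positivity)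
      _ ≤ 1 * (2 * |Real.sin (π * s)|) := by linarith
  rw [fejer_eq_norm_sq]
  have h2 : ‖∑ k ∈ range m, Complex.exp (2 * π * k * s * Complex.I)‖ ^ 2 ≤ (1 / (2 * |s|)) ^ 2 :=
    pow_le_pow_left₀ (norm_nonneg _) hsum 2
  calc 1 / (m : ℝ) * ‖∑ k ∈ range m, Complex.exp (2 * π * k * s * Complex.I)‖ ^ 2
      ≤ 1 / (m : ℝ) * (1 / (2 * |s|)) ^ 2 := mul_le_mul_of_nonneg_left h2 (by positivity)
    _ = 1 / (4 * m * s ^ 2) := by rw [div_pow, mul_pow, sq_abs]; field_simp; ring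

/-- `∫_{-1/2}^{1/2} cos 2π d s ds = [d = 0]` for an integer difference `d = k - k'`. [folklore] -/
theorem integral_cos_sub (k k' : ℕ) :
    ∫ s in (-(1/2):ℝ)..(1/2), Real.cos (2 * π * ((k : ℝ) - k') * s) = if k = k' then 1 else 0 := by
  split_ifs with h
  · subst h; simp; norm_num
  · have hd : ((k : ℝ) - k') ≠ 0 := by
      rw [sub_ne_zero]; exact_mod_cast h
    have hc : 2 * π * ((k : ℝ) - k') ≠ 0 := by positivity
    rw [show (fun s => Real.cos (2 * π * ((k : ℝ) - k') * s)) = fun s => Real.cos ((2 * π * ((k : ℝ) - k')) * s)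
      from rfl, intervalIntegral.integral_comp_mul_left _ hc, integral_cos]
    have h1 : Real.sin (2 * π * ((k : ℝ) - k') * (1 / 2)) = 0 := by
      rw [show 2 * π * ((k : ℝ) - k') * (1 / 2) = (((k : ℤ) - k' : ℤ) : ℝ) * π by push_cast; ring]
      exact Real.sin_int_mul_pi _
    have h2 : Real.sin (2 * π * ((k : ℝ) - k') * (-(1 / 2))) = 0 := by
      rw [show 2 * π * ((k : ℝ) - k') * (-(1 / 2)) = ((-((k : ℤ) - k') : ℤ) : ℝ) * π by push_cast; ring]
      exact Real.sin_int_mul_pi _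
    rw [h1, h2]; simp

/-- **Unit mass**: `∫_{-1/2}^{1/2} F_m = 1` (`m ≥ 1`). [folklore] -/
theorem integral_fejer {m : ℕ} (hm : 0 < m) : ∫ s in (-(1/2):ℝ)..(1/2), fejer m s = 1 := by
  have hmr : (m : ℝ) ≠ 0 := by exact_mod_cast hm.ne'
  simp_rw [fejer_eq_sum_sum]
  have hik : ∀ k k' : ℕ, IntervalIntegrable (fun x : ℝ => Real.cos (2 * π * ((k : ℝ) - k') * x)) volume
      (-(1/2)) (1/2) := fun k k' => Continuous.intervalIntegrable (by fun_prop) _ _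
  have hik2 : ∀ k : ℕ, IntervalIntegrable (fun x : ℝ => ∑ k' ∈ range m, Real.cos (2 * π * ((k : ℝ) - k') * x))
      volume (-(1/2)) (1/2) := fun k => Continuous.intervalIntegrable (by fun_prop) _ _
  rw [intervalIntegral.integral_const_mul, intervalIntegral.integral_finsetSum (fun k _ => hik2 k)]
  simp_rw [intervalIntegral.integral_finsetSum (fun k' _ => hik _ k'), integral_cos_sub]
  rw [Finset.sum_congr rfl fun k hk => (Finset.sum_ite_eq (range m) k (fun _ => (1:ℝ))),
    Finset.sum_congr rfl fun k (hk : k ∈ range m) => if_pos hk]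
  simp [hmr]

/-- **Concentration**: `∫_{-1/2}^{1/2} |s| F_m(s) ds ≤ 1/√m`. [folklore] -/
theorem integral_abs_mul_fejer_le {m : ℕ} (hm : 0 < m) :
    ∫ s in (-(1/2):ℝ)..(1/2), |s| * fejer m s ≤ 1 / Real.sqrt m := by
  have hmr : (0 : ℝ) < m := by exact_mod_cast hm
  set a : ℝ := 1 / (2 * Real.sqrt m) with ha
  have hsq : 0 < Real.sqrt m := Real.sqrt_pos.mpr hmr
  have ha0 : 0 < a := by positivity
  -- pointwise: `|s| F_m(s) ≤ a F_m(s) + 1/(4 m a)` on `[-1/2, 1/2]`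
  have hpt : ∀ s ∈ Set.Icc (-(1/2):ℝ) (1/2), |s| * fejer m s ≤ a * fejer m s + 1 / (4 * m * a) := by
    intro s hs
    have hF0 := fejer_nonneg m s
    have hlast : 0 ≤ 1 / (4 * m * a) := by positivity
    by_cases hsa : |s| ≤ a
    · nlinarith
    · push Not at hsa
      have hs0 : s ≠ 0 := by intro h; rw [h, abs_zero] at hsa; linarith
      have hs12 : |s| ≤ 1 / 2 := abs_le.mpr ⟨by linarith [hs.1], hs.2⟩
      have hF := fejer_le_inv_sq hm hs0 hs12
      have h1 : |s| * fejer m s ≤ 1 / (4 * m * |s|) := by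
        calc |s| * fejer m s ≤ |s| * (1 / (4 * m * s ^ 2)) := mul_le_mul_of_nonneg_left hF (abs_nonneg _)
          _ = 1 / (4 * m * |s|) := by
              rw [← sq_abs]; field_simp
      have h2 : 1 / (4 * m * |s|) ≤ 1 / (4 * m * a) :=
        one_div_le_one_div_of_le (by positivity) (by nlinarith)
      nlinarith
  have hint : IntervalIntegrable (fun s => |s| * fejer m s) volume (-(1/2)) (1/2) :=
    ((continuous_abs.mul (continuous_fejer m)).intervalIntegrable _ _)
  have hint2 : IntervalIntegrable (fun s => a * fejer m s + 1 / (4 * m * a)) volume (-(1/2)) (1/2) :=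
    (((continuous_fejer m).const_mul a).add continuous_const).intervalIntegrable _ _
  calc ∫ s in (-(1/2):ℝ)..(1/2), |s| * fejer m s ≤ ∫ s in (-(1/2):ℝ)..(1/2), (a * fejer m s + 1 / (4 * m * a)) :=
        intervalIntegral.integral_mono_on (by norm_num) hint hint2 hpt
    _ = a * 1 + 1 / (4 * m * a) := by
        rw [intervalIntegral.integral_add ((continuous_fejer m).intervalIntegrable _ _ |>.const_mul a)
          (intervalIntegrable_const), intervalIntegral.integral_const_mul, integral_fejer hm,
          intervalIntegral.integral_const]
        norm_num
    _ = 1 / Real.sqrt m := by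
        rw [ha]
        have : Real.sqrt m * Real.sqrt m = m := Real.mul_self_sqrt hmr.le
        field_simp
        nlinarith [this]

/-! ### Finite Fourier expansions against a continuous periodic test function -/

/-- `∫_0^1 F(t) ∑_{k,k'} c_{kk'} cos 2πd(r-t) dt = ∑_{k,k'} c_{kk'} (cos 2πdr · F̂c(d) + sin 2πdr · F̂s(d))`,
`d = k - k'`. [folklore] -/
theorem integral_mul_sum_cos_sub {F : ℝ → ℝ} (hF : Continuous F) (m : ℕ) (c : ℕ → ℕ → ℝ) (r : ℝ) :
    ∫ t in (0:ℝ)..1, F t * ∑ k ∈ range m, ∑ k' ∈ range m, c k k' * Real.cos (2 * π * ((k : ℝ) - k') * (r - t)) =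
      ∑ k ∈ range m, ∑ k' ∈ range m, c k k' *
        (Real.cos (2 * π * ((k : ℝ) - k') * r) * (∫ t in (0:ℝ)..1, F t * Real.cos (2 * π * ((k : ℝ) - k') * t)) +
          Real.sin (2 * π * ((k : ℝ) - k') * r) * (∫ t in (0:ℝ)..1, F t * Real.sin (2 * π * ((k : ℝ) - k') * t))) := by
  have hpt : ∀ t, F t * ∑ k ∈ range m, ∑ k' ∈ range m, c k k' * Real.cos (2 * π * ((k : ℝ) - k') * (r - t)) =
      ∑ k ∈ range m, ∑ k' ∈ range m, (c k k' * Real.cos (2 * π * ((k : ℝ) - k') * r) *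
        (F t * Real.cos (2 * π * ((k : ℝ) - k') * t)) +
        c k k' * Real.sin (2 * π * ((k : ℝ) - k') * r) * (F t * Real.sin (2 * π * ((k : ℝ) - k') * t))) := by
    intro t
    rw [Finset.mul_sum]
    refine Finset.sum_congr rfl fun k _ => ?_
    rw [Finset.mul_sum]
    refine Finset.sum_congr rfl fun k' _ => ?_
    rw [show 2 * π * ((k : ℝ) - k') * (r - t) = 2 * π * ((k : ℝ) - k') * r - 2 * π * ((k : ℝ) - k') * t by ring,
      Real.cos_sub]
    ring
  simp_rw [hpt]
  have h1 : ∀ k k' : ℕ, IntervalIntegrable (fun t => c k k' * Real.cos (2 * π * ((k : ℝ) - k') * r) *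
        (F t * Real.cos (2 * π * ((k : ℝ) - k') * t))) volume 0 1 :=
    fun k k' => Continuous.intervalIntegrable (by fun_prop) _ _
  have h2 : ∀ k k' : ℕ, IntervalIntegrable (fun t =>
        c k k' * Real.sin (2 * π * ((k : ℝ) - k') * r) * (F t * Real.sin (2 * π * ((k : ℝ) - k') * t))) volume 0 1 :=
    fun k k' => Continuous.intervalIntegrable (by fun_prop) _ _
  have hI : ∀ k k' : ℕ, IntervalIntegrable (fun t => c k k' * Real.cos (2 * π * ((k : ℝ) - k') * r) *
        (F t * Real.cos (2 * π * ((k : ℝ) - k') * t)) +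
        c k k' * Real.sin (2 * π * ((k : ℝ) - k') * r) * (F t * Real.sin (2 * π * ((k : ℝ) - k') * t))) volume 0 1 :=
    fun k k' => (h1 k k').add (h2 k k')
  have hI2 : ∀ k : ℕ, IntervalIntegrable (fun t => ∑ k' ∈ range m, (c k k' * Real.cos (2 * π * ((k : ℝ) - k') * r) *
        (F t * Real.cos (2 * π * ((k : ℝ) - k') * t)) +
        c k k' * Real.sin (2 * π * ((k : ℝ) - k') * r) * (F t * Real.sin (2 * π * ((k : ℝ) - k') * t)))) volume 0 1 :=
    fun k => Continuous.intervalIntegrable (by fun_prop) _ _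
  have hkk : ∀ k k' : ℕ, ∫ t in (0:ℝ)..1, (c k k' * Real.cos (2 * π * ((k : ℝ) - k') * r) *
        (F t * Real.cos (2 * π * ((k : ℝ) - k') * t)) +
        c k k' * Real.sin (2 * π * ((k : ℝ) - k') * r) * (F t * Real.sin (2 * π * ((k : ℝ) - k') * t))) =
      c k k' * (Real.cos (2 * π * ((k : ℝ) - k') * r) * (∫ t in (0:ℝ)..1, F t * Real.cos (2 * π * ((k : ℝ) - k') * t)) +
          Real.sin (2 * π * ((k : ℝ) - k') * r) * (∫ t in (0:ℝ)..1, F t * Real.sin (2 * π * ((k : ℝ) - k') * t))) := by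
    intro k k'
    rw [intervalIntegral.integral_add (h1 k k') (h2 k k'), intervalIntegral.integral_const_mul,
      intervalIntegral.integral_const_mul]
    ring
  rw [intervalIntegral.integral_finsetSum (fun k _ => hI2 k)]
  refine Finset.sum_congr rfl fun k _ => ?_
  rw [intervalIntegral.integral_finsetSum (fun k' _ => hI k k')]
  exact Finset.sum_congr rfl fun k' _ => hkk k k'

/-- The Fejér smoothing of a test function: `(F ∗ F_m)(y) = ∫_0^1 F(t) F_m(y - t) dt`. [folklore] -/
def fejerSmooth (m : ℕ) (F : ℝ → ℝ) (y : ℝ) : ℝ := ∫ t in (0:ℝ)..1, F t * fejer m (y - t)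

/-- **Finite Fourier expansion of `F ∗ F_m`.** [folklore] -/
theorem fejerSmooth_eq_sum {F : ℝ → ℝ} (hF : Continuous F) (m : ℕ) (y : ℝ) :
    fejerSmooth m F y = (1 / m) * ∑ k ∈ range m, ∑ k' ∈ range m,
      (Real.cos (2 * π * ((k : ℝ) - k') * y) * (∫ t in (0:ℝ)..1, F t * Real.cos (2 * π * ((k : ℝ) - k') * t)) +
        Real.sin (2 * π * ((k : ℝ) - k') * y) * (∫ t in (0:ℝ)..1, F t * Real.sin (2 * π * ((k : ℝ) - k') * t))) := by
  unfold fejerSmooth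
  have h := integral_mul_sum_cos_sub hF m (fun _ _ => (1 : ℝ)) y
  simp only [one_mul] at h ⊢
  simp_rw [fejer_eq_sum_sum]
  rw [← h, ← intervalIntegral.integral_const_mul]
  refine intervalIntegral.integral_congr fun t _ => ?_
  ring

/-- The smoothing as an average of translates: `(F ∗ F_m)(y) = ∫_{-1/2}^{1/2} F(y - s) F_m(s) ds`
for `1`-periodic `F`. [folklore] -/
theorem fejerSmooth_eq_integral_translate {F : ℝ → ℝ} (hper : Function.Periodic F 1) (m : ℕ) (y : ℝ) :
    fejerSmooth m F y = ∫ s in (-(1/2):ℝ)..(1/2), F (y - s) * fejer m s := by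
  unfold fejerSmooth
  have h1 : ∫ t in (0:ℝ)..1, F t * fejer m (y - t) = ∫ t in (0:ℝ)..1, (fun s => F (y - s) * fejer m s) (y - t) := by
    refine intervalIntegral.integral_congr fun t _ => ?_
    simp only [sub_sub_cancel]
  rw [h1, intervalIntegral.integral_comp_sub_left (fun s => F (y - s) * fejer m s) y]
  have hp : Function.Periodic (fun s => F (y - s) * fejer m s) 1 := by
    intro s
    simp only
    rw [fejer_periodic m s, show y - (s + 1) = y - s - 1 by ring, hper.sub_eq]
  have := hp.intervalIntegral_add_eq (y - 1) (-(1/2))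
  rw [show y - 1 + 1 = y - 0 by ring, show -(1/2) + 1 = (1/2 : ℝ) by norm_num] at this
  rw [this]

/-! ### Gaussian averages of the kernel -/

/-- `∫ cos(ty) 𝒩(0,V)(dy) = e^{-Vt²/2}` and `∫ sin(ty) 𝒩(0,V)(dy) = 0`. [folklore] -/
theorem integral_cos_sin_gaussian (V : ℝ≥0) (t : ℝ) :
    ∫ y, Real.cos (t * y) ∂(gaussianReal 0 V) = Real.exp (-(V * t ^ 2 / 2)) ∧
      ∫ y, Real.sin (t * y) ∂(gaussianReal 0 V) = 0 := by
  have hchar := charFun_gaussianReal (μ := 0) (v := V) t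
  rw [charFun_apply_real] at hchar
  simp only [Complex.ofReal_zero, mul_zero, zero_mul, zero_sub] at hchar
  have hI : Integrable (fun y : ℝ => Complex.exp (t * y * Complex.I)) (gaussianReal 0 V) := by
    refine Integrable.mono' (integrable_const (1 : ℝ)) (by fun_prop) (ae_of_all _ fun y => ?_)
    rw [show (t * y * Complex.I : ℂ) = ((t * y : ℝ) : ℂ) * Complex.I by push_cast; ring, Complex.norm_exp_ofReal_mul_I]
  have hre := integral_re hI
  have him := integral_im hI
  simp only [RCLike.re_to_complex, RCLike.im_to_complex] at hre him
  rw [hchar] at hre him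
  have e1 : ∀ y : ℝ, (Complex.exp (t * y * Complex.I)).re = Real.cos (t * y) := fun y => by
    rw [show (t * y * Complex.I : ℂ) = ((t * y : ℝ) : ℂ) * Complex.I by push_cast; ring, Complex.exp_ofReal_mul_I_re]
  have e2 : ∀ y : ℝ, (Complex.exp (t * y * Complex.I)).im = Real.sin (t * y) := fun y => by
    rw [show (t * y * Complex.I : ℂ) = ((t * y : ℝ) : ℂ) * Complex.I by push_cast; ring, Complex.exp_ofReal_mul_I_im]
  simp only [e1] at hre
  simp only [e2] at him
  have e3 : (-((V : ℂ) * (t : ℂ) ^ 2 / 2)) = ((-(V * t ^ 2 / 2) : ℝ) : ℂ) := by push_cast; ring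
  rw [e3, Complex.exp_ofReal_re] at hre
  rw [e3, Complex.exp_ofReal_im] at him
  exact ⟨hre, him⟩

/-- The Gaussian average of the Fejér kernel, `G(r) = ∫ F_m(r - y) 𝒩(0,V)(dy)`. [folklore] -/
def fejerGauss (m : ℕ) (V : ℝ≥0) (r : ℝ) : ℝ := ∫ y, fejer m (r - y) ∂(gaussianReal 0 V)

/-- **Fourier form of the Gaussian average**: `G(r) = (1/m) ∑_{k,k'} e^{-2π²d²V} cos 2πdr`. [folklore] -/
theorem fejerGauss_eq_sum (m : ℕ) (V : ℝ≥0) (r : ℝ) :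
    fejerGauss m V r = (1 / m) * ∑ k ∈ range m, ∑ k' ∈ range m,
      Real.exp (-(2 * π ^ 2 * ((k : ℝ) - k') ^ 2 * V)) * Real.cos (2 * π * ((k : ℝ) - k') * r) := by
  unfold fejerGauss
  simp_rw [fejer_eq_sum_sum]
  rw [integral_const_mul]
  congr 1
  have hIc : ∀ k k' : ℕ, Integrable (fun y : ℝ => Real.cos (2 * π * ((k : ℝ) - k') * (r - y))) (gaussianReal 0 V) :=
    fun k k' => Integrable.mono' (integrable_const (1 : ℝ)) (by fun_prop)
      (ae_of_all _ fun y => by rw [Real.norm_eq_abs]; exact Real.abs_cos_le_one _)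
  rw [integral_finsetSum _ (fun k _ => integrable_finsetSum _ fun k' _ => hIc k k')]
  refine Finset.sum_congr rfl fun k _ => ?_
  rw [integral_finsetSum _ (fun k' _ => hIc k k')]
  refine Finset.sum_congr rfl fun k' _ => ?_
  set d : ℝ := (k : ℝ) - k' with hd
  have hcs := integral_cos_sin_gaussian V (2 * π * d)
  have e1 : ∀ y : ℝ, Real.cos (2 * π * d * (r - y)) =
      Real.cos (2 * π * d * r) * Real.cos (2 * π * d * y) + Real.sin (2 * π * d * r) * Real.sin (2 * π * d * y) := by
    intro y; rw [show 2 * π * d * (r - y) = 2 * π * d * r - 2 * π * d * y by ring, Real.cos_sub]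
  simp_rw [e1]
  have hI1 : Integrable (fun y : ℝ => Real.cos (2 * π * d * r) * Real.cos (2 * π * d * y)) (gaussianReal 0 V) :=
    (Integrable.mono' (integrable_const (1 : ℝ)) (by fun_prop)
      (ae_of_all _ fun y => by rw [Real.norm_eq_abs]; exact Real.abs_cos_le_one _)).const_mul _
  have hI2 : Integrable (fun y : ℝ => Real.sin (2 * π * d * r) * Real.sin (2 * π * d * y)) (gaussianReal 0 V) :=
    (Integrable.mono' (integrable_const (1 : ℝ)) (by fun_prop)
      (ae_of_all _ fun y => by rw [Real.norm_eq_abs]; exact Real.abs_sin_le_one _)).const_mul _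
  rw [integral_add hI1 hI2, integral_const_mul, integral_const_mul, hcs.1, hcs.2, mul_zero, add_zero, mul_comm]
  congr 1
  congr 1
  ring

/-- `G` is `1`-periodic. [folklore] -/
theorem fejerGauss_periodic (m : ℕ) (V : ℝ≥0) : Function.Periodic (fejerGauss m V) 1 := by
  intro r
  unfold fejerGauss
  refine integral_congr_ae (ae_of_all _ fun y => ?_)
  show fejer m (r + 1 - y) = fejer m (r - y)
  rw [show r + 1 - y = r - y + 1 by ring, fejer_periodic]

/-- The Gaussian constant `g(V) = e^{-9/(8V)}/√(2πV)`, the minimum of the `𝒩(0,V)` density on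
`[-3/2, 3/2]`. [folklore] -/
def gaussLower (V : ℝ≥0) : ℝ := (Real.sqrt (2 * π * V))⁻¹ * Real.exp (-(9 / (8 * V)))

/-- `g(V) > 0`. [folklore] -/
theorem gaussLower_pos {V : ℝ≥0} (hV : V ≠ 0) : 0 < gaussLower V := by
  unfold gaussLower
  have : (0 : ℝ) < V := by exact_mod_cast pos_iff_ne_zero.mpr hV
  positivity

/-- **Positivity of the Gaussian average**: `G(r) ≥ g(V)` for all `r` (`m ≥ 1`). The kernel is
non-negative with unit mass on every period, and the Gaussian density is `≥ g(V)` on `[-3/2, 3/2]`.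
[folklore] -/
theorem gaussLower_le_fejerGauss {m : ℕ} (hm : 0 < m) {V : ℝ≥0} (hV : V ≠ 0) (r : ℝ) :
    gaussLower V ≤ fejerGauss m V r := by
  -- reduce to `r ∈ [0, 1)`
  have hper := fejerGauss_periodic m V
  rw [← hper.sub_int_mul_eq ⌊r⌋, mul_one]
  set r' : ℝ := r - ⌊r⌋ with hr'
  have hr'0 : 0 ≤ r' := by rw [hr']; linarith [Int.floor_le r]
  have hr'1 : r' < 1 := by rw [hr']; linarith [Int.lt_floor_add_one r]
  have hVr : (0 : ℝ) < V := by exact_mod_cast pos_iff_ne_zero.mpr hV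
  unfold fejerGauss
  rw [integral_gaussianReal_eq_integral_smul hV]
  simp only [smul_eq_mul]
  -- the integrand is non-negative and `≥ g(V) F_m(r' - y)` on `[r' - 1/2, r' + 1/2]`
  have hφ0 : ∀ y, 0 ≤ gaussianPDFReal 0 V y := fun y => gaussianPDFReal_nonneg 0 V y
  have hint : Integrable (fun y => gaussianPDFReal 0 V y * fejer m (r' - y)) := by
    refine Integrable.mono' ((integrable_gaussianPDFReal 0 V).mul_const (2 * m)) (by
      have : Continuous fun y => fejer m (r' - y) := (continuous_fejer m).comp (continuous_const.sub continuous_id)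
      exact ((measurable_gaussianPDFReal 0 V).mul this.measurable).aestronglyMeasurable) (ae_of_all _ fun y => ?_)
    rw [Real.norm_eq_abs, abs_mul, abs_of_nonneg (hφ0 y), abs_of_nonneg (fejer_nonneg _ _)]
    exact mul_le_mul_of_nonneg_left (fejer_le m _) (hφ0 y)
  have hset : ∫ y in Set.Icc (r' - 1/2) (r' + 1/2), gaussianPDFReal 0 V y * fejer m (r' - y) ≤
      ∫ y, gaussianPDFReal 0 V y * fejer m (r' - y) :=
    setIntegral_le_integral hint (ae_of_all _ fun y => mul_nonneg (hφ0 y) (fejer_nonneg _ _))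
  refine le_trans ?_ hset
  -- lower bound of the density on the window
  have hdens : ∀ y ∈ Set.Icc (r' - 1/2) (r' + 1/2), gaussLower V ≤ gaussianPDFReal 0 V y := by
    intro y hy
    have hy2 : y ^ 2 ≤ 9 / 4 := by
      have h1 : -(3/2) ≤ y := by linarith [hy.1]
      have h2 : y ≤ 3 / 2 := by linarith [hy.2]
      nlinarith
    unfold gaussLower
    rw [gaussianPDFReal_def]
    simp only [sub_zero]
    refine mul_le_mul_of_nonneg_left (Real.exp_le_exp.mpr ?_) (by positivity)
    rw [neg_div, neg_le_neg_iff, div_le_div_iff₀ (by positivity) (by positivity)]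
    nlinarith
  have hmono : ∫ y in Set.Icc (r' - 1/2) (r' + 1/2), gaussLower V * fejer m (r' - y) ≤
      ∫ y in Set.Icc (r' - 1/2) (r' + 1/2), gaussianPDFReal 0 V y * fejer m (r' - y) := by
    refine setIntegral_mono_on ?_ hint.integrableOn measurableSet_Icc fun y hy =>
      mul_le_mul_of_nonneg_right (hdens y hy) (fejer_nonneg _ _)
    exact (((continuous_fejer m).comp (continuous_const.sub continuous_id)).const_mul _
      |>.integrableOn_Icc)
  refine le_trans (le_of_eq ?_) hmono
  -- `∫_{r'-1/2}^{r'+1/2} F_m(r' - y) dy = 1`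
  rw [integral_const_mul]
  have h1 : ∫ y in Set.Icc (r' - 1/2) (r' + 1/2), fejer m (r' - y) = ∫ y in (r' - 1/2)..(r' + 1/2), fejer m (r' - y) := by
    rw [intervalIntegral.integral_of_le (by linarith), integral_Icc_eq_integral_Ioc]
  rw [h1, intervalIntegral.integral_comp_sub_left (fejer m) r',
    show r' - (r' + 1/2) = -(1/2 : ℝ) by ring, show r' - (r' - 1/2) = (1/2 : ℝ) by ring, integral_fejer hm, mul_one]

/-! ### The smoothing inequality -/

/-- **Fejér smoothing turns low-frequency control and a translation bound into a minorisation.**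
For a real random variable `Y` on a probability space, suppose
(i) `|𝔼φ(Y) - 𝔼φ(Y-s)| ≤ A_φ (C₁|s| + ε₀)` for continuous `1`-periodic `|φ| ≤ A_φ` and `|s| ≤ 1/2`;
(ii) `|𝔼cos 2πdY - e^{-2π²d²V}cos 2πda| ≤ δ`, `|𝔼sin 2πdY - e^{-2π²d²V} sin 2πda| ≤ δ` for
`d = k - k'`, `k, k' < m`. Then for continuous `1`-periodic `0 ≤ F ≤ A`,
`(g(V) - 2mδ) ∫_0^1 F - A (C₁/√m + ε₀) ≤ 𝔼F(Y)`. Serves the lower bound (5.2) of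
[cite: AjankiHuveneers2011, Prop. 5.1]; the inequality itself is [folklore]. -/
theorem smoothing_lower_bound {Ω : Type*} [MeasurableSpace Ω] (P : Measure Ω) [IsProbabilityMeasure P]
    {Y : Ω → ℝ} (hY : Measurable Y) {V : ℝ≥0} (hV : V ≠ 0) {a δ C₁ ε₀ : ℝ} {m : ℕ} (hm : 0 < m)
    (hδ : 0 ≤ δ)
    (htrans : ∀ φ : ℝ → ℝ, Continuous φ → Function.Periodic φ 1 → ∀ Aφ : ℝ, (∀ y, |φ y| ≤ Aφ) →
      ∀ s ∈ Set.Icc (-(1/2):ℝ) (1/2), |∫ ω, φ (Y ω) ∂P - ∫ ω, φ (Y ω - s) ∂P| ≤ Aφ * (C₁ * |s| + ε₀))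
    (hcos : ∀ k k' : ℕ, k < m → k' < m →
      |∫ ω, Real.cos (2 * π * ((k : ℝ) - k') * Y ω) ∂P -
        Real.exp (-(2 * π ^ 2 * ((k : ℝ) - k') ^ 2 * V)) * Real.cos (2 * π * ((k : ℝ) - k') * a)| ≤ δ)
    (hsin : ∀ k k' : ℕ, k < m → k' < m →
      |∫ ω, Real.sin (2 * π * ((k : ℝ) - k') * Y ω) ∂P -
        Real.exp (-(2 * π ^ 2 * ((k : ℝ) - k') ^ 2 * V)) * Real.sin (2 * π * ((k : ℝ) - k') * a)| ≤ δ)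
    {F : ℝ → ℝ} (hFc : Continuous F) (hFper : Function.Periodic F 1) (hF0 : ∀ y, 0 ≤ F y) {A : ℝ}
    (hFA : ∀ y, F y ≤ A) (hC₁ : 0 ≤ C₁) :
    (gaussLower V - 2 * m * δ) * (∫ t in (0:ℝ)..1, F t) - A * (C₁ / Real.sqrt m + ε₀) ≤ ∫ ω, F (Y ω) ∂P := by
  have hmr : (0 : ℝ) < m := by exact_mod_cast hm
  have hA0 : 0 ≤ A := (hF0 0).trans (hFA 0)
  have hFabs : ∀ y, |F y| ≤ A := fun y => by rw [abs_of_nonneg (hF0 y)]; exact hFA y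
  set IF : ℝ := ∫ t in (0:ℝ)..1, F t with hIF
  have hIF0 : 0 ≤ IF := intervalIntegral.integral_nonneg zero_le_one fun t _ => hF0 t
  -- notation for expectations
  have hLint : ∀ φ : ℝ → ℝ, Continuous φ → (∀ y, |φ y| ≤ max A 1) → Integrable (fun ω => φ (Y ω)) P := by
    intro φ hφ hb
    exact Integrable.mono' (integrable_const (max A 1)) ((hφ.measurable.comp hY).aestronglyMeasurable)
      (ae_of_all _ fun ω => by rw [Real.norm_eq_abs]; exact hb _)
  -- Step 1: `𝔼(F ∗ F_m)(Y) = ∫ F_m(s) 𝔼F(Y - s) ds`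
  set FK : ℝ → ℝ := fejerSmooth m F with hFK
  have hprod_int : Integrable (Function.uncurry fun (ω : Ω) (s : ℝ) => F (Y ω - s) * fejer m s)
      (P.prod (volume.restrict (Set.Ioc (-(1/2):ℝ) (1/2)))) := by
    have hmeas : Measurable (Function.uncurry fun (ω : Ω) (s : ℝ) => F (Y ω - s) * fejer m s) :=
      (hFc.measurable.comp ((hY.comp measurable_fst).sub measurable_snd)).mul
        ((continuous_fejer m).measurable.comp measurable_snd)
    haveI : IsFiniteMeasure (volume.restrict (Set.Ioc (-(1/2):ℝ) (1/2))) := ⟨by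
      rw [Measure.restrict_apply_univ, Real.volume_Ioc]; exact ENNReal.ofReal_lt_top⟩
    refine Integrable.mono' (integrable_const (A * (2 * m))) hmeas.aestronglyMeasurable (ae_of_all _ fun p => ?_)
    rw [Real.norm_eq_abs]
    show |F (Y p.1 - p.2) * fejer m p.2| ≤ A * (2 * m)
    rw [abs_mul, abs_of_nonneg (fejer_nonneg _ _)]
    exact mul_le_mul (hFabs _) (fejer_le _ _) (fejer_nonneg _ _) hA0
  have hstep1 : ∫ ω, FK (Y ω) ∂P = ∫ s in (-(1/2):ℝ)..(1/2), fejer m s * ∫ ω, F (Y ω - s) ∂P := by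
    have h1 : ∫ ω, FK (Y ω) ∂P = ∫ ω, (∫ s in Set.Ioc (-(1/2):ℝ) (1/2), F (Y ω - s) * fejer m s) ∂P := by
      refine integral_congr_ae (ae_of_all _ fun ω => ?_)
      show fejerSmooth m F (Y ω) = _
      rw [fejerSmooth_eq_integral_translate hFper, intervalIntegral.integral_of_le (by norm_num)]
    rw [h1, integral_integral_swap hprod_int, intervalIntegral.integral_of_le (by norm_num)]
    refine setIntegral_congr_fun measurableSet_Ioc fun s _ => ?_
    show ∫ ω, F (Y ω - s) * fejer m s ∂P = fejer m s * ∫ ω, F (Y ω - s) ∂P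
    rw [integral_mul_const, mul_comm]
  -- Step 2: `|𝔼F(Y) - 𝔼(F ∗ F_m)(Y)| ≤ A (C₁/√m + ε₀)`
  have hEF : ∫ ω, F (Y ω) ∂P = ∫ s in (-(1/2):ℝ)..(1/2), fejer m s * ∫ ω, F (Y ω) ∂P := by
    rw [intervalIntegral.integral_mul_const, integral_fejer hm, one_mul]
  have hcontE : Continuous fun s => ∫ ω, F (Y ω - s) ∂P := by
    have : Continuous fun s => ∫ ω, (Function.uncurry fun (ω : Ω) (s : ℝ) => F (Y ω - s)) (ω, s) ∂P := by
      refine continuous_of_dominated (bound := fun _ => A) (fun s => ?_) (fun s => ae_of_all _ fun ω => ?_)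
        (integrable_const A) (ae_of_all _ fun ω => ?_)
      · exact (hFc.measurable.comp (hY.sub measurable_const)).aestronglyMeasurable
      · rw [Real.norm_eq_abs]; exact hFabs _
      · show Continuous fun s => F (Y ω - s)
        exact hFc.comp (continuous_const.sub continuous_id)
    exact this
  have hstep2 : |∫ ω, F (Y ω) ∂P - ∫ ω, FK (Y ω) ∂P| ≤ A * (C₁ / Real.sqrt m + ε₀) := by
    have i1 : IntervalIntegrable (fun s => fejer m s * ∫ ω, F (Y ω) ∂P) volume (-(1/2)) (1/2) :=
      ((continuous_fejer m).mul continuous_const).intervalIntegrable _ _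
    have i2 : IntervalIntegrable (fun s => fejer m s * ∫ ω, F (Y ω - s) ∂P) volume (-(1/2)) (1/2) :=
      ((continuous_fejer m).mul hcontE).intervalIntegrable _ _
    rw [hstep1, hEF, ← intervalIntegral.integral_sub i1 i2]
    have hb : ∀ s ∈ Set.Icc (-(1/2):ℝ) (1/2), |fejer m s * ∫ ω, F (Y ω) ∂P - fejer m s * ∫ ω, F (Y ω - s) ∂P| ≤
        A * C₁ * (|s| * fejer m s) + A * ε₀ * fejer m s := by
      intro s hs
      rw [← mul_sub, abs_mul, abs_of_nonneg (fejer_nonneg _ _)]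
      have := htrans F hFc hFper A hFabs s hs
      have h0 := fejer_nonneg m s
      nlinarith
    calc |∫ s in (-(1/2):ℝ)..(1/2), fejer m s * ∫ ω, F (Y ω) ∂P - fejer m s * ∫ ω, F (Y ω - s) ∂P|
        ≤ ∫ s in (-(1/2):ℝ)..(1/2), A * C₁ * (|s| * fejer m s) + A * ε₀ * fejer m s := by
          refine (intervalIntegral.abs_integral_le_integral_abs (by norm_num)).trans ?_
          refine intervalIntegral.integral_mono_on (by norm_num) ?_ ?_ hb
          · exact (i1.sub i2).abs
          · exact (((continuous_abs.mul (continuous_fejer m)).const_mul _).add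
              ((continuous_fejer m).const_mul _)).intervalIntegrable _ _
      _ = A * C₁ * (∫ s in (-(1/2):ℝ)..(1/2), |s| * fejer m s) + A * ε₀ * 1 := by
          rw [intervalIntegral.integral_add, intervalIntegral.integral_const_mul, intervalIntegral.integral_const_mul,
            integral_fejer hm]
          · exact ((continuous_abs.mul (continuous_fejer m)).const_mul _).intervalIntegrable _ _
          · exact ((continuous_fejer m).const_mul _).intervalIntegrable _ _
      _ ≤ A * C₁ * (1 / Real.sqrt m) + A * ε₀ * 1 := by
          have := integral_abs_mul_fejer_le hm
          have h0 : 0 ≤ A * C₁ := mul_nonneg hA0 hC₁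
          nlinarith
      _ = A * (C₁ / Real.sqrt m + ε₀) := by ring
  -- Step 3: the finite Fourier expansion of `𝔼(F ∗ F_m)(Y)`
  set Fc : ℕ → ℕ → ℝ := fun k k' => ∫ t in (0:ℝ)..1, F t * Real.cos (2 * π * ((k : ℝ) - k') * t) with hFcdef
  set Fs : ℕ → ℕ → ℝ := fun k k' => ∫ t in (0:ℝ)..1, F t * Real.sin (2 * π * ((k : ℝ) - k') * t) with hFsdef
  have hFc_le : ∀ k k', |Fc k k'| ≤ IF := by
    intro k k'
    simp only [hFcdef]
    refine (intervalIntegral.abs_integral_le_integral_abs zero_le_one).trans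
      (intervalIntegral.integral_mono_on zero_le_one ?_ (hFc.intervalIntegrable _ _) fun t _ => ?_)
    · exact (Continuous.intervalIntegrable (by fun_prop) _ _)
    · rw [abs_mul, abs_of_nonneg (hF0 t)]
      exact (mul_le_of_le_one_right (hF0 t) (Real.abs_cos_le_one _))
  have hFs_le : ∀ k k', |Fs k k'| ≤ IF := by
    intro k k'
    simp only [hFsdef]
    refine (intervalIntegral.abs_integral_le_integral_abs zero_le_one).trans
      (intervalIntegral.integral_mono_on zero_le_one ?_ (hFc.intervalIntegrable _ _) fun t _ => ?_)
    · exact (Continuous.intervalIntegrable (by fun_prop) _ _)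
    · rw [abs_mul, abs_of_nonneg (hF0 t)]
      exact (mul_le_of_le_one_right (hF0 t) (Real.abs_sin_le_one _))
  set Lc : ℕ → ℕ → ℝ := fun k k' => ∫ ω, Real.cos (2 * π * ((k : ℝ) - k') * Y ω) ∂P with hLc
  set Ls : ℕ → ℕ → ℝ := fun k k' => ∫ ω, Real.sin (2 * π * ((k : ℝ) - k') * Y ω) ∂P with hLs
  have hIcos : ∀ k k' : ℕ, Integrable (fun ω => Real.cos (2 * π * ((k : ℝ) - k') * Y ω) * Fc k k') P := fun k k' =>
    (Integrable.mono' (integrable_const (1:ℝ)) ((Real.continuous_cos.measurable.comp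
      (hY.const_mul _)).aestronglyMeasurable)
      (ae_of_all _ fun ω => by rw [Real.norm_eq_abs]; exact Real.abs_cos_le_one _)).mul_const _
  have hIsin : ∀ k k' : ℕ, Integrable (fun ω => Real.sin (2 * π * ((k : ℝ) - k') * Y ω) * Fs k k') P := fun k k' =>
    (Integrable.mono' (integrable_const (1:ℝ)) ((Real.continuous_sin.measurable.comp
      (hY.const_mul _)).aestronglyMeasurable)
      (ae_of_all _ fun ω => by rw [Real.norm_eq_abs]; exact Real.abs_sin_le_one _)).mul_const _
  have hIadd : ∀ k k' : ℕ, Integrable (fun ω => Real.cos (2 * π * ((k : ℝ) - k') * Y ω) * Fc k k' +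
      Real.sin (2 * π * ((k : ℝ) - k') * Y ω) * Fs k k') P := fun k k' => (hIcos k k').add (hIsin k k')
  have hIadd2 : ∀ k : ℕ, Integrable (fun ω => ∑ k' ∈ range m, (Real.cos (2 * π * ((k : ℝ) - k') * Y ω) * Fc k k' +
      Real.sin (2 * π * ((k : ℝ) - k') * Y ω) * Fs k k')) P := fun k => integrable_finsetSum _ fun k' _ => hIadd k k'
  have hstep3 : ∫ ω, FK (Y ω) ∂P = (1 / m) * ∑ k ∈ range m, ∑ k' ∈ range m, (Lc k k' * Fc k k' + Ls k k' * Fs k k') := by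
    have h1 : ∀ ω, FK (Y ω) = (1 / m) * ∑ k ∈ range m, ∑ k' ∈ range m,
        (Real.cos (2 * π * ((k : ℝ) - k') * Y ω) * Fc k k' + Real.sin (2 * π * ((k : ℝ) - k') * Y ω) * Fs k k') :=
      fun ω => fejerSmooth_eq_sum hFc m (Y ω)
    simp_rw [h1]
    rw [integral_const_mul, integral_finsetSum _ (fun k _ => hIadd2 k)]
    congr 1
    refine Finset.sum_congr rfl fun k _ => ?_
    rw [integral_finsetSum _ (fun k' _ => hIadd k k')]
    refine Finset.sum_congr rfl fun k' _ => ?_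
    rw [integral_add (hIcos k k') (hIsin k k'), integral_mul_const, integral_mul_const]
  -- Step 4: replace the Fourier coefficients of the law by the Gaussian ones
  set γ : ℕ → ℕ → ℝ := fun k k' => Real.exp (-(2 * π ^ 2 * ((k : ℝ) - k') ^ 2 * V)) with hγ
  have hterm : ∀ k ∈ range m, ∀ k' ∈ range m,
      γ k k' * (Real.cos (2 * π * ((k : ℝ) - k') * a) * Fc k k' + Real.sin (2 * π * ((k : ℝ) - k') * a) * Fs k k') -
        2 * δ * IF ≤ Lc k k' * Fc k k' + Ls k k' * Fs k k' := by
    intro k hk k' hk'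
    have hk2 := Finset.mem_range.mp hk
    have hk'2 := Finset.mem_range.mp hk'
    have e1 := abs_le.mp ((hcos k k' hk2 hk'2).trans (le_refl δ))
    have e2 := abs_le.mp ((hsin k k' hk2 hk'2).trans (le_refl δ))
    have f1 := abs_le.mp (hFc_le k k')
    have f2 := abs_le.mp (hFs_le k k')
    -- `(Lc - γ cos a) Fc ≥ -δ |Fc| ≥ -δ IF`, same for the sine term
    have g1 : -(δ * IF) ≤ (Lc k k' - γ k k' * Real.cos (2 * π * ((k : ℝ) - k') * a)) * Fc k k' := by
      have : |(Lc k k' - γ k k' * Real.cos (2 * π * ((k : ℝ) - k') * a)) * Fc k k'| ≤ δ * IF := by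
        rw [abs_mul]; exact mul_le_mul (hcos k k' hk2 hk'2) (hFc_le k k') (abs_nonneg _) hδ
      exact (abs_le.mp this).1
    have g2 : -(δ * IF) ≤ (Ls k k' - γ k k' * Real.sin (2 * π * ((k : ℝ) - k') * a)) * Fs k k' := by
      have : |(Ls k k' - γ k k' * Real.sin (2 * π * ((k : ℝ) - k') * a)) * Fs k k'| ≤ δ * IF := by
        rw [abs_mul]; exact mul_le_mul (hsin k k' hk2 hk'2) (hFs_le k k') (abs_nonneg _) hδ
      exact (abs_le.mp this).1
    nlinarith [g1, g2]
  have hstep4 : (1 / m) * ∑ k ∈ range m, ∑ k' ∈ range m,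
      γ k k' * (Real.cos (2 * π * ((k : ℝ) - k') * a) * Fc k k' + Real.sin (2 * π * ((k : ℝ) - k') * a) * Fs k k') -
        2 * m * δ * IF ≤ ∫ ω, FK (Y ω) ∂P := by
    rw [hstep3]
    have hsum := Finset.sum_le_sum fun k hk => Finset.sum_le_sum fun k' hk' => hterm k hk k' hk'
    simp only [Finset.sum_sub_distrib, Finset.sum_const, Finset.card_range, nsmul_eq_mul] at hsum
    have hm0 : 0 ≤ 1 / (m : ℝ) := by positivity
    have := mul_le_mul_of_nonneg_left hsum hm0
    have e : 1 / (m : ℝ) * ((m : ℝ) * ((m : ℝ) * (2 * δ * IF))) = 2 * m * δ * IF := by field_simp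
    rw [mul_sub, e] at this
    exact this
  -- Step 5: the Gaussian main term is `∫_0^1 F(t) G(a - t) dt ≥ g(V) ∫_0^1 F`
  have hmain : (1 / m) * ∑ k ∈ range m, ∑ k' ∈ range m,
      γ k k' * (Real.cos (2 * π * ((k : ℝ) - k') * a) * Fc k k' + Real.sin (2 * π * ((k : ℝ) - k') * a) * Fs k k') =
      ∫ t in (0:ℝ)..1, F t * fejerGauss m V (a - t) := by
    have h := integral_mul_sum_cos_sub hFc m γ a
    simp only [hFcdef, hFsdef]
    rw [← h, ← intervalIntegral.integral_const_mul]
    refine intervalIntegral.integral_congr fun t _ => ?_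
    simp only [fejerGauss_eq_sum, hγ]
    ring
  have hmain_ge : gaussLower V * IF ≤ ∫ t in (0:ℝ)..1, F t * fejerGauss m V (a - t) := by
    rw [hIF, ← intervalIntegral.integral_const_mul]
    have hGc : Continuous fun t => fejerGauss m V (a - t) := by
      have : Continuous (fejerGauss m V) := by
        simp only [show fejerGauss m V = fun r => fejerGauss m V r from rfl, fejerGauss_eq_sum]
        fun_prop
      exact this.comp (continuous_const.sub continuous_id)
    refine intervalIntegral.integral_mono_on zero_le_one ((hFc.const_mul _).intervalIntegrable _ _)
      ((hFc.mul hGc).intervalIntegrable _ _) fun t _ => ?_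
    rw [mul_comm]
    exact mul_le_mul_of_nonneg_left (gaussLower_le_fejerGauss hm hV _) (hF0 t)
  -- conclusion
  have h2 := (abs_le.mp hstep2).1
  rw [hmain] at hstep4
  nlinarith [hstep4, hmain_ge, h2]

end Literature.Barriers.AtomisticToContinuum.HeatConduction

end
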